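import Summits.CriticalPhenomena.PercolationContinuityZ3.Theorems.Transplant.Slab111HubShapeT13
import HarnessLib

/-!
# The HUB ROUTING of the `(111)`-films — the UNCLIPPED shape `U` as a `ShapeB` (block types `t_R, s_R ≥ 2`)

builds on p205010 (kernel theorem, internal audit signed; external expert review pending) — NOT used in this file.  Lane `prim-bschramm`, seat
`prim-bschramm-p2` (gen 37; class C1b; memo `HOME/bschramm/P2-LATTICES.md` §135); helper file (`--supports stmt-CriticalPhenomena-4575 --as helper`).
The cleared set of the blocks with `t_R, s_R ≥ 2` is «Slab111HubW18».`W18`: the lift of the radius-`2` hexagon minus its six corners at the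
boundary levels `0` and `k`.  Gen 36 treated these blocks by a dedicated file («Slab111HubU19»); the zone-free dispatcher of gen 37 treats every
block type through «Slab111HubShape».`ShapeB`, so this file records the same cleared set as the shape **`shapeU`** (`colsB = (tnZ ≤ 2)`,
`badBot = badTop = cornerB`, window unrestricted, `pcB = colsB`) with **`shapeU_valid`**: `ShapeB.Valid` for every block type of the family.
[cite: DuminilCopinSidoraviciusTassion2016, §2.3 (proof of Fact 2: the three disjoint paths γ_u, γ_v, γ_w in B_R(z))]
-/

namespace Summit.CriticalPhenomena.PercolationContinuityZ3.Theorems.Transplant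

namespace Slab111

/-- **The unclipped shape** (radius-`2` hexagon, corners bad on both boundary levels). [folklore] -/
def shapeU : ShapeB where
  colsB := fun q => decide (tnZ q ≤ 2)
  badBot := cornerB
  badTop := cornerB
  inwinB := fun _ => true
  pcB := fun q => decide (tnZ q ≤ 2)
  cols := [(0, 0), (1, 0), (0, -1), (-1, 1), (-1, 0), (0, 1), (1, -1), (2, 0), (0, -2), (-2, 2), (-2, 0), (0, 2), (2, -2), (1, 1), (2, -1), (1, -2),
    (-1, -1), (-2, 1), (-1, 2)]

/-- The radius-`2` hexagon is the listed `19` columns. [folklore] -/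
theorem mem_cols_of_tnZ_U {q : ℤ × ℤ} (h : tnZ q ≤ 2) : q ∈ shapeU.cols := by
  obtain ⟨a, b⟩ := q
  simp only [tnZ, max_le_iff, abs_le] at h
  obtain ⟨⟨ha1, ha2⟩, ⟨hb1, hb2⟩, hab1, hab2⟩ := h
  unfold shapeU
  simp only [List.mem_cons, Prod.mk.injEq, List.not_mem_nil, or_false]
  interval_cases a <;> interval_cases b <;> omega

/-- **Validity of the shape `U`** for every block type with `t_R, s_R ≥ 2`. [folklore] -/
theorem shapeU_valid {tR tD sR sD : ℕ} (htR : 2 ≤ tR) (hsR : 2 ≤ sR) (htD : tR ≤ tD) (hsD : sR ≤ sD) : shapeU.Valid tR tD sR sD := by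
  have key : ∀ q : ℤ × ℤ, tnZ q ≤ 2 → ∀ t s : ℕ, 2 ≤ t → 2 ≤ s → inBlkB t s q = true := by
    intro q hq t s ht hs
    obtain ⟨a, b⟩ := q
    simp only [tnZ, max_le_iff, abs_le] at hq
    unfold inBlkB; simp only [tnZ, Bool.and_eq_true, decide_eq_true_eq, max_le_iff, abs_le]
    refine ⟨⟨⟨?_, ?_, ?_⟩, ?_⟩, ?_⟩ <;> omega
  refine ⟨fun q hq => ?_, fun q ht _ => ?_, fun q => ?_, fun q _ _ => rfl, fun q hq => ?_⟩
  · unfold shapeU at hq; simp only [decide_eq_true_eq] at hq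
    exact key q hq tD sD (by omega) (by omega)
  · have hc : tnZ q ≤ 2 := by omega
    refine ⟨by unfold shapeU; simpa using hc, ?_, ?_⟩ <;>
    · unfold shapeU; rw [Bool.eq_false_iff]; intro hb
      rw [cornerB_iff] at hb
      rcases hb with rfl | rfl | rfl | rfl | rfl | rfl <;> simp [tnZ] at ht
  · constructor
    · intro hp
      unfold shapeU at hp ⊢; simp only [decide_eq_true_eq] at hp ⊢
      exact ⟨hp, key q hp tR sR htR hsR⟩
    · rintro ⟨hc, -⟩; unfold shapeU at hc ⊢; exact hc
  · unfold shapeU at hq; simp only [decide_eq_true_eq] at hq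
    exact mem_cols_of_tnZ_U hq

end Slab111

end Summit.CriticalPhenomena.PercolationContinuityZ3.Theorems.Transplant
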